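import Summits.CriticalPhenomena.PercolationContinuityZ3.Theses.PercNearOneGluing
import Summits.CriticalPhenomena.PercolationContinuityZ3.Theorems.PercNearOneGluingNearOneGluingBhkLogSupermodular
import Summits.CriticalPhenomena.PercolationContinuityZ3.Theorems.PercNearOneGluingNearOneGluingBhkClusterAssociation
import Summits.CriticalPhenomena.PercolationContinuityZ3.Theorems.PercNearOneGluingNearOneGluingTerminalSeparation
import Summits.CriticalPhenomena.PercolationContinuityZ3.Theorems.PercNearOneGluingNearOneGluingWeightContinuity
import Summits.CriticalPhenomena.PercolationContinuityZ3.Theorems.PercNearOneGluingNearOneGluingSingleFinger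
import Summits.CriticalPhenomena.PercolationContinuityZ3.Theorems.PercNearOneGluingNearOneGluingDyadicThinning
import Literature.Probability.Percolation.ConditionalPositiveAssociation
import Literature.Probability.Percolation.PercolationProofs
import HarnessLib.Audit

/-!
# Line `bhk-dyadic-thinning` — crux `PercNearOneGluing.NearOneGluing`
# (stmt-CriticalPhenomena-4574 = Kozma–Nitzan Conjecture 3, arXiv:2401.12397 p. 15)

crux-plan round 1 · planner-cruxplan-stmt-CriticalPhenomena-4574-bhk-dyadic-thinning-0 · idea card
`Cruxes/NearOneGluing/Ideas/bhk-dyadic-thinning.md` (triage r1: pass ×3; merge target of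
`sparse-relay-bhk-log-uniform` and `dyadic-thinning-bhk`; sharpenings of r1-1/2/3 applied — see the line
card `Lines/bhk-dyadic-thinning.md`) · `lean check` rc 0, sorries only in the five `stub_*`,
`#h21_check_skeleton` ok (theorem `NearOneGluing_of`, closed = false).

## The line

Notation (one finite weighted graph: vertices `Fin n`, weights `w`, `μ = prodBernoulli w`; relay set `A`,
source `o`, target `b`; `N(ω) = |C(o) ∩ A| = #{a ∈ A : o ↔ a}`; "bad" = `{o ↮ b}`).

1. **BHK** (van den Berg–Häggström–Kahn 2006, Thm 1.3; tree-vendored NAMED FACT, unproved):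
   given `{s ↮ X}` the open edge cluster `C_s` is positively associated.            — `stub_bhkClusterAssociation`
2. **Terminal separation** (BHK Thm 1.5 with the second vertex replaced by a SET `T`, Remark 1 p. 5;
   = Kozma–Nitzan Lemma 1(i) specialised): `P(o ↔ a | a ↮ T, T pairwise separated) ≥ P(o ↔ a | a ↮ T)`,
   denominator-free.                                                                  — `stub_terminalSeparation`
3. **Single finger** (KN Lemma 2 with SINGLETON blocks on the ground set `A' ∪ {b}`):
   `Σ_{a∈A'} P(o ↔ a | a ↮ (A'∖a) ∪ {b}) ≤ 1`, hence `P(|C(o) ∩ A'| = 1, o ↮ b) ≤ max_{a∈A'} P(a ↮ b)`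
   — the first `|A'|`-FREE inequality on this crux.                                     — `stub_singleFinger`
4. **Dyadic thinning**: run 3. on independent Bernoulli(`1/(K 2^j)`) sub-relays of `A`; a footprint
   `N ∈ [K2^j, K2^{j+1})` leaves exactly one survivor with probability `≥ 1/16`; Fubini over the finite coin
   space: `P(o ↮ b, K ≤ N < K·2^L) ≤ 16·L·max_a P(a ↮ b)` — 16δ per dyadic scale.      — `stub_dyadicThinning`
   Corollary (sorry-free below, `logGluing_of_windowBound`): **LogGluing**
   `P(o ↮ b) ≤ P(o ↮ A) + 16 (⌊log₂|A|⌋ + 1) · max_a P(a ↮ b)`, i.e. Conjecture 3 uniformly on `|A| ≤ 2^{cε/δ}`.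
5. **Residual = the doom window** (OPEN; the registered hard stub): with `L = ⌈1/δ⌉`,
   `P(o ↮ b, 2^L ≤ N ≤ |A|·2^{-L}) ≤ ε` under the crux hypotheses at level `δ = δ(ε)`.   — `stub_doomWindow`
   Everything outside the window is paid for by 4.: `N = 0` costs `P(o ↮ A) ≤ δ`, `N ∈ [1, 2^L)` costs
   `16Lδ`, `N > |A| 2^{-L}` costs `16(L+1)δ` (only `L+1` dyadic scales are left below `|A|`), and the
   composition chooses `δ ≤ ε/(64(L+1))` AFTER the residual has frozen `L` — so the crux follows
   (`nearOneGluing_of_parts`, `NearOneGluing_of`). Conversely the crux implies the residual trivially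
   (`doomWindow_of_nearOneGluing`), so `stub_doomWindow` is EQUIVALENT to the crux given stubs 1–4
   (`nearOneGluing_iff_doomWindow`): it is Conjecture 3 restricted to the configurations the BHK lever
   provably cannot reach — pockets of `o` that swallow exponentially many (`≥ 2^{1/δ}`) individually
   `(1−δ)`-reliable relay points yet stay exponentially sparse in `A` (`≤ |A| 2^{-1/δ}`) and miss `b`.
   This is stated plainly so nobody mistakes it for progress on X itself (triage r1-3); the line's
   DELIVERABLES are stubs 1–4 (LogGluing becomes a theorem) and the doom-window anatomy of counterexamples.
   NOT a stub, on purpose: the card's K2 `VerticalBudget` (Σ over all dyadic levels of the single-finger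
   masses ≤ C·δ) — it is equivalent to the LINEAR crux `P(o↮b) ≤ P(o↮A) + C'·max_a P(a↮b)`, i.e. to route
   item AdditiveGluing (stmt-4576) up to the constant, and would be that item in costume.

## Disproof used (cdisprove v1–v5 on stmt-4574, read through the item's evidence notes — the bodies under
run/gate/evidence are not mounted in planner jails; nothing has landed under Theorems/NearOneGluing/Negative/)

* `nearOneGluing_false_without_relay` / `_without_reliability`: honoured — `nearOneGluing_of_parts` uses the
  o-side hypothesis exactly once (piece `N = 0`, `P(o ↮ A) ≤ δ`) and the relay reliability as the `t = δ` of
  stubs 3–4 and of the residual; no stub assumes a strengthening of either hypothesis.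
* `nearOneGluing_of_card_le` (δ = ε/(k+1)), `nearOneGluing_of_mean_le`: superseded as counterexample floors by
  `logGluing_of_windowBound` (a counterexample at `(ε, δ)` needs `⌊log₂|A|⌋ + 1 ≥ (ε − δ)/(16δ)`) and by the
  doom window (with the composition's `δ`, a counterexample with `P(o ↮ b) ≥ ε` carries ≥ ε/2 of its mass
  on `2^{⌈1/δ₅⌉} ≤ N ≤ |A|·2^{-⌈1/δ₅⌉}`).
* `unionBound_rate_sharp` (no δ = cε with c > 1/2), `not_nearOneGluingLossless`: consistent — the composition's
  `δ(ε) = min(δ₅(ε/4), ε/(64(L+1))) ≤ ε/64`.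
* `iff_nearOneGluing` (NoHeavyLowerTail ⇔ X, cdisprove-4575): not used; the doom window is a third equivalent
  form, cut by footprint SIZE at the two exponential scales instead of by the mean.
* No stub is an instance of a refuted statement: `ledger negatives --problem CriticalPhenomena` (8 entries,
  2026-08-16) has no finite-graph gluing entry; stubs 2–4 are exact-checked (0 violations, scripts/check_stubs.py: all graphs on
  ≤ 4 vertices incl. weight-1/weight-0 edges and all degenerate placements of o, a, b, T, A', plus random
  weighted 5-vertex graphs; independently cruxtri r1-1/2/3 C1–C2 and cdisprove v5, 0/146 468 and 0/9 500).
-/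

/-!
## Lead's reshape (prover-line-stmt-CriticalPhenomena-4574-0, 2026-08-16) — 7 registered stubs
* `stub_bhkLogSupermodular` (NEW): BHK Thm 1.1 for EVENTS at `Fin n` — the induction with Ahlswede–Daykin.
* `stub_bhkClusterAssociation` (CHANGED to an implication): Thm 1.1-for-events ⇒ Thm 1.3 functional form
  (the "standard reduction"); its CONCLUSION is unchanged (what `stub_terminalSeparation` consumes).
* `stub_weightContinuity` (NEW): `w ↦ μ_w(E)` is continuous on a finite graph; fed to `stub_singleFinger`
  (CHANGED: one extra hypothesis) to dispose of the null separation event by perturbing the weights.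
* `stub_terminalSeparation`, `stub_dyadicThinning`, `stub_doomWindow`: unchanged.  Composition
  `NearOneGluing_of` unchanged in substance.  The lead holds `stub_doomWindow`.
-/

namespace Summit.CriticalPhenomena.PercolationContinuityZ3.Cruxes.NearOneGluing.BhkDyadicThinning

open scoped BigOperators Classical
open MeasureTheory Set
open Literature.Probability.LatticeModels (prodBernoulli)
open Literature.Probability.Percolation (openConn measurableSet_openConn_holds)
open Summit.CriticalPhenomena.PercolationContinuityZ3.Theses.PercNearOneGluing (NearOneGluing)

/-! ## Registered stubs (5)

Every stub is stated over existing declarations only (`prodBernoulli`, `openConn`, `openGraph`,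
`openEdgeCluster`, `BondConfig`), fully qualified, with `open scoped Classical` for the `Finset.filter`
decidability exactly as in the route file (provers restating a stub need `open MeasureTheory` for the
`∫ ω in D, … ∂μ` notation of stub 1 and `open scoped Classical`). -/

/-- **stub_bhkLogSupermodular** — van den Berg–Häggström–Kahn 2006, **Thm 1.1** (pp. 3–5 of arXiv:math/0408176,
read in full), at `V = Fin n`, for EVENTS: if `A, B ⊆ BondConfig V` are *increasing and determined by the open edge
cluster `C_s`* (`ω ∈ A ∧ C_s(ω) ⊆ C_s(ω') → ω' ∈ A`) and `X, Y ⊆ V ∖ {s}`, then with `R_W = {s ↮ W}`,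
`μ(A ∩ R_X) · μ(B ∩ R_Y) ≤ μ(A ∩ B ∩ R_{X∩Y}) · μ(R_{X∪Y})` (log-supermodularity in the target set).
Why true: published theorem.  Printed proof (one page): induction on the number of vertices.  Base `X ∩ Y = ∅`:
two applications of Harris (`prodBernoulli_harris`, `_harris_lower`, `_harris_upper_lower`).  Step `Z := X ∩ Y ≠ ∅`:
WLOG `A` does not depend on the edges `E_X` meeting `X` (replace `A` by `{ω | ω ∖ E_X ∈ A}`), likewise `B`/`E_Y`; let
`𝐒(ω) ⊆ V ∖ Z` be the set of vertices joined to `Z` by an OPEN EDGE — its law is a product measure on subsets of `V ∖ Z`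
(`π(S)π(T) = π(S∩T)π(S∪T)`), so by the Ahlswede–Daykin four-functions theorem (Mathlib `Finset.four_functions_theorem`)
it suffices to check `f₁(S) f₂(T) ≤ f₃(S∩T) f₄(S∪T)` for `f₁(S) = μ(A ∩ R_X ∩ {𝐒 = S})`, …; and on `{𝐒 = S}` one has,
for `W ⊇ Z` and `D` not depending on `E_W`, `D ∩ R_W = D ∩ R'_{(W∖Z) ∪ S}` where `R'` is disconnection in the open
graph with the edges at `Z` deleted (`ω ∖ E_Z`), the two sides being independent of `{𝐒 = S}` (determined by
`E_Z`) — so the induction hypothesis for the smaller live vertex set `V ∖ Z` (same vertex type, same measure: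
formalise the induction over a Finset `U` of live vertices, connectivity through `ω ∩ E(U)`) and monotonicity of
`R'` in its index set finish.  Size: L.  Serves crux stmt-4575's line as well (fact wi-26995). -/
theorem stub_bhkLogSupermodular :
    ∀ (n : ℕ) (w : Sym2 (Fin n) → unitInterval) (s : Fin n) (X Y : Set (Fin n))
      (A B : Set (Literature.Probability.Percolation.BondConfig (Fin n))),
      (∀ ω ω', ω ∈ A → Literature.Probability.Percolation.openEdgeCluster ω s ⊆
          Literature.Probability.Percolation.openEdgeCluster ω' s → ω' ∈ A) →
      (∀ ω ω', ω ∈ B → Literature.Probability.Percolation.openEdgeCluster ω s ⊆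
          Literature.Probability.Percolation.openEdgeCluster ω' s → ω' ∈ B) →
      s ∉ X → s ∉ Y →
      (Literature.Probability.LatticeModels.prodBernoulli w).real
          (A ∩ {ω | ∀ x ∈ X, ¬ (Literature.Probability.Percolation.openGraph ω).Reachable s x}) *
        (Literature.Probability.LatticeModels.prodBernoulli w).real
          (B ∩ {ω | ∀ y ∈ Y, ¬ (Literature.Probability.Percolation.openGraph ω).Reachable s y}) ≤
      (Literature.Probability.LatticeModels.prodBernoulli w).real
          (A ∩ B ∩ {ω | ∀ z ∈ X ∩ Y, ¬ (Literature.Probability.Percolation.openGraph ω).Reachable s z}) *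
        (Literature.Probability.LatticeModels.prodBernoulli w).real
          {ω | ∀ z ∈ X ∪ Y, ¬ (Literature.Probability.Percolation.openGraph ω).Reachable s z} :=
  Summit.CriticalPhenomena.PercolationContinuityZ3.Theorems.stub_bhkLogSupermodular

/-- **stub_bhkClusterAssociation** — van den Berg–Häggström–Kahn, *Some conditional correlation inequalities
for percolation and related processes*, RSA 29 (2006), doi:10.1002/rsa.20102 = arXiv:math/0408176, **Thm 1.3**
(p. 6 of the CWI preprint, read): for a vertex `s` and a vertex SET `X ∌ s`, functions increasing in the open
edge cluster `C_s` are positively correlated given `{s ↮ X}`, in the denominator-free form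
`(∫_D f)(∫_D g) ≤ μ(D) ∫_D f g`, `D = {s ↮ X}`, `f = F ∘ C_s`, `g = G ∘ C_s`, `F, G` monotone.  This is VERBATIM
the tree's named fact `Literature.Probability.Percolation.BHK2006_clusterConditionalPositiveAssociation`
(ConditionalPositiveAssociation.lean, cite item wi-26995, also wanted by the line on crux stmt-4575) specialised
to `V = Fin n` (sorry-free certificate `bhkClusterAssociationFin_of_fact` below), written out so that the
registered signature is self-contained.
RESHAPED by the lead (2026-08-16): the stub is now the IMPLICATION "Thm 1.1 for events (`stub_bhkLogSupermodular`)
⇒ Thm 1.3 functional, denominator-free" — BHK's "standard (and easy) reduction" (p. 4): take `Y = X` in Thm 1.1 to get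
`μ(A∩D)μ(B∩D) ≤ μ(A∩B∩D)μ(D)` for increasing `C_s`-determined EVENTS, then extend bilinearly: the configuration space
`Set (Sym2 (Fin n))` is finite, so `f = F ∘ C_s` takes finitely many values `v₀ < v₁ < … < v_m` and
`f = v₀ + Σ_k (v_{k+1} − v_k)·1{f ≥ v_{k+1}}` (layer cake / Abel summation), each `{f ≥ v}` being an increasing
`C_s`-determined event (`F` monotone); constants contribute `0` to `μ(D)∫_D fg − (∫_D f)(∫_D g)`, which is bilinear,
so it is a nonnegative combination of event instances.  Integrals over the finite space are finite sums
(`MeasureTheory.integral_fintype` / indicator algebra).  Size: M.  (Alternatively closes in one line from a `…_holds`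
proof of the tree fact `BHK2006_clusterConditionalPositiveAssociation`, certificate `bhkClusterAssociationFin_of_fact`.) -/
theorem stub_bhkClusterAssociation :
    (∀ (n : ℕ) (w : Sym2 (Fin n) → unitInterval) (s : Fin n) (X Y : Set (Fin n))
      (A B : Set (Literature.Probability.Percolation.BondConfig (Fin n))),
      (∀ ω ω', ω ∈ A → Literature.Probability.Percolation.openEdgeCluster ω s ⊆
          Literature.Probability.Percolation.openEdgeCluster ω' s → ω' ∈ A) →
      (∀ ω ω', ω ∈ B → Literature.Probability.Percolation.openEdgeCluster ω s ⊆
          Literature.Probability.Percolation.openEdgeCluster ω' s → ω' ∈ B) →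
      s ∉ X → s ∉ Y →
      (Literature.Probability.LatticeModels.prodBernoulli w).real
          (A ∩ {ω | ∀ x ∈ X, ¬ (Literature.Probability.Percolation.openGraph ω).Reachable s x}) *
        (Literature.Probability.LatticeModels.prodBernoulli w).real
          (B ∩ {ω | ∀ y ∈ Y, ¬ (Literature.Probability.Percolation.openGraph ω).Reachable s y}) ≤
      (Literature.Probability.LatticeModels.prodBernoulli w).real
          (A ∩ B ∩ {ω | ∀ z ∈ X ∩ Y, ¬ (Literature.Probability.Percolation.openGraph ω).Reachable s z}) *
        (Literature.Probability.LatticeModels.prodBernoulli w).real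
          {ω | ∀ z ∈ X ∪ Y, ¬ (Literature.Probability.Percolation.openGraph ω).Reachable s z}) →
    ∀ (n : ℕ) (w : Sym2 (Fin n) → unitInterval) (s : Fin n) (X : Set (Fin n))
      (F G : Set (Sym2 (Fin n)) → ℝ), Monotone F → Monotone G → s ∉ X →
      (∫ ω in {ω : Literature.Probability.Percolation.BondConfig (Fin n) |
            ∀ x ∈ X, ¬ (Literature.Probability.Percolation.openGraph ω).Reachable s x},
          F (Literature.Probability.Percolation.openEdgeCluster ω s)
            ∂(Literature.Probability.LatticeModels.prodBernoulli w)) *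
        (∫ ω in {ω : Literature.Probability.Percolation.BondConfig (Fin n) |
            ∀ x ∈ X, ¬ (Literature.Probability.Percolation.openGraph ω).Reachable s x},
          G (Literature.Probability.Percolation.openEdgeCluster ω s)
            ∂(Literature.Probability.LatticeModels.prodBernoulli w)) ≤
      (Literature.Probability.LatticeModels.prodBernoulli w).real
          {ω : Literature.Probability.Percolation.BondConfig (Fin n) |
            ∀ x ∈ X, ¬ (Literature.Probability.Percolation.openGraph ω).Reachable s x} *
        ∫ ω in {ω : Literature.Probability.Percolation.BondConfig (Fin n) |
            ∀ x ∈ X, ¬ (Literature.Probability.Percolation.openGraph ω).Reachable s x},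
          F (Literature.Probability.Percolation.openEdgeCluster ω s) *
            G (Literature.Probability.Percolation.openEdgeCluster ω s)
            ∂(Literature.Probability.LatticeModels.prodBernoulli w) :=
  Summit.CriticalPhenomena.PercolationContinuityZ3.Theorems.stub_bhkClusterAssociation

/-- **stub_terminalSeparation** — the TWO-cluster BHK inequality in the vertex–SET form the line needs
(BHK 2006 Thm 1.5, eq. (9) p. 7, with `t` replaced by a set `T` as licensed by Remark 1 p. 5; it is exactly
Kozma–Nitzan's "BHK" statement §2.2 p. 5 with `A = {a}`, `B = T`, `f = 1{o ↔ a}` (increasing, defined on the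
cluster of `a`), `g = 1{T pairwise separated}` (decreasing, defined on the EDGE cluster of `T`), i.e. their
Lemma 1(i), second case).  Denominator-free: with `E = {o ↔ a}`, `D = {a ↮ T}`, `Q = {T pairwise separated}`,
`μ(E ∩ D) · μ(D ∩ Q) ≤ μ(D) · μ(E ∩ D ∩ Q)`, i.e. `P(o ↔ a | D ∩ Q) ≥ P(o ↔ a | D)` when defined.
No side condition is needed (`a ∈ T` or `o ∈ T` make both sides 0; `T = ∅` gives equality).
Why true from the fact: BHK's own proof of Thm 1.5 (pp. 7–8) never uses that `t` is a single vertex —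
condition on `C_a = W` (edge cluster), then by the domain Markov property of `prodBernoulli`
(tree: `prodBernoulli_real_inter_of_determinedBy` & co., ProdBernoulliIndependence.lean) the configuration off
`W̄` is fresh percolation on `G − (V(W) ∪ {a})`, so `G(W) := P(Q | C_a = W)` is INCREASING in `W`;
`1{o ↔ a}` is an increasing function of `C_a` (`reachable_iff_exists_mem_openEdgeCluster`,
TwoClusterConditionalAssociation.lean); apply the hypothesis (Thm 1.3 with `s = a`, `X = T`) to the pair
`(1{o↔a}, G)` and undo the conditioning (tower property over the finite partition `{C_a = W}`).
NOT covered by the tree's vertex–vertex fact `BHK2006_twoClusterConditionalAssociation` (there `t` is a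
vertex; contracting `T` to a point leaves the simple-graph `prodBernoulli` setting).  Exact-checked, 0
violations (38 690 instances incl. all degenerate ones).  Size: M–L (the Markov-property bookkeeping). -/
theorem stub_terminalSeparation :
    (∀ (n : ℕ) (w : Sym2 (Fin n) → unitInterval) (s : Fin n) (X : Set (Fin n))
      (F G : Set (Sym2 (Fin n)) → ℝ), Monotone F → Monotone G → s ∉ X →
      (∫ ω in {ω : Literature.Probability.Percolation.BondConfig (Fin n) |
            ∀ x ∈ X, ¬ (Literature.Probability.Percolation.openGraph ω).Reachable s x},
          F (Literature.Probability.Percolation.openEdgeCluster ω s)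
            ∂(Literature.Probability.LatticeModels.prodBernoulli w)) *
        (∫ ω in {ω : Literature.Probability.Percolation.BondConfig (Fin n) |
            ∀ x ∈ X, ¬ (Literature.Probability.Percolation.openGraph ω).Reachable s x},
          G (Literature.Probability.Percolation.openEdgeCluster ω s)
            ∂(Literature.Probability.LatticeModels.prodBernoulli w)) ≤
      (Literature.Probability.LatticeModels.prodBernoulli w).real
          {ω : Literature.Probability.Percolation.BondConfig (Fin n) |
            ∀ x ∈ X, ¬ (Literature.Probability.Percolation.openGraph ω).Reachable s x} *
        ∫ ω in {ω : Literature.Probability.Percolation.BondConfig (Fin n) |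
            ∀ x ∈ X, ¬ (Literature.Probability.Percolation.openGraph ω).Reachable s x},
          F (Literature.Probability.Percolation.openEdgeCluster ω s) *
            G (Literature.Probability.Percolation.openEdgeCluster ω s)
            ∂(Literature.Probability.LatticeModels.prodBernoulli w)) →
    ∀ (n : ℕ) (w : Sym2 (Fin n) → unitInterval) (T : Finset (Fin n)) (o a : Fin n),
      (Literature.Probability.LatticeModels.prodBernoulli w).real
          (Literature.Probability.Percolation.openConn o a ∩
            {ω | ∀ t ∈ T, ω ∉ Literature.Probability.Percolation.openConn a t}) *
        (Literature.Probability.LatticeModels.prodBernoulli w).real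
          ({ω | ∀ t ∈ T, ω ∉ Literature.Probability.Percolation.openConn a t} ∩
            {ω | ∀ t ∈ T, ∀ t' ∈ T, t ≠ t' → ω ∉ Literature.Probability.Percolation.openConn t t'}) ≤
      (Literature.Probability.LatticeModels.prodBernoulli w).real
          {ω | ∀ t ∈ T, ω ∉ Literature.Probability.Percolation.openConn a t} *
        (Literature.Probability.LatticeModels.prodBernoulli w).real
          (Literature.Probability.Percolation.openConn o a ∩
            ({ω | ∀ t ∈ T, ω ∉ Literature.Probability.Percolation.openConn a t} ∩
              {ω | ∀ t ∈ T, ∀ t' ∈ T, t ≠ t' → ω ∉ Literature.Probability.Percolation.openConn t t'})) :=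
  Summit.CriticalPhenomena.PercolationContinuityZ3.Theorems.stub_terminalSeparation

/-- **stub_weightContinuity** — connection probabilities are continuous in the weights (RESHAPE by the lead,
2026-08-16: isolates the perturbation `w ↦ (1−η)·w` that the single-finger lemma needs when the separation event is
null).  For a FINITE graph every event `E ⊆ BondConfig (Fin n)` has `μ_w(E) = Σ_{ω ∈ E} ∏_e (w_e if e ∈ ω else 1 − w_e)`,
a polynomial in the weights (atom formula: `prodBernoulli_real_eq_infinitePi` + `Measure.infinitePi_pi` on the box
`Set.pi univ`; finite additivity over the finite type `Set (Sym2 (Fin n))`), hence `w ↦ μ_w(E)` is continuous for the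
product topology on `Sym2 (Fin n) → unitInterval`.  Size: S–M. [folklore; Grimmett 1999 §2.1 (finite-volume
probabilities are polynomials in p)] -/
theorem stub_weightContinuity :
    ∀ (n : ℕ) (E : Set (Literature.Probability.Percolation.BondConfig (Fin n))),
      Continuous fun w : Sym2 (Fin n) → unitInterval =>
        (Literature.Probability.LatticeModels.prodBernoulli w).real E :=
  Summit.CriticalPhenomena.PercolationContinuityZ3.Theorems.stub_weightContinuity

/-- **stub_singleFinger** — the SINGLE-FINGER LEMMA from terminal separation (Kozma–Nitzan arXiv:2401.12397
Lemma 2, p. 6, with singleton blocks `X_k = {a_k}` on the ground set `A' ∪ {b}`, `X = A'`, `Xᶜ = {b}`):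
if `P(a ↮ b) ≤ t` for every `a ∈ A'` then `P(|C(o) ∩ A'| = 1, o ↮ b) ≤ t` — no `|A'|` anywhere.
Proof (elementary given the hypothesis): let `T_a = (A' ∖ {a}) ∪ {b}`, `D_a = {a ↮ T_a}`,
`M = {A' ∪ {b} pairwise separated} = D_a ∩ {T_a pairwise separated}` (the same event for every `a`).
(i) `{|C(o) ∩ A'| = 1, o ↮ b} = ⋃_{a∈A'} ({o ↔ a} ∩ D_a)` (the finger `a` lies in `C(o)`, so `o ↮ x ⇔ a ↮ x`);
(ii) hypothesis: `μ({o↔a} ∩ D_a) · μ(M) ≤ μ(D_a) · μ({o↔a} ∩ M) ≤ t · μ({o↔a} ∩ M)`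
(`D_a ⊆ {a ↮ b}`); (iii) on `M` the events `{o ↔ a}`, `a ∈ A'`, are pairwise disjoint, so
`Σ_a μ({o↔a} ∩ M) ≤ μ(M)`; divide by `μ(M)`.  The null case `μ(M) = 0` happens iff two points of `A' ∪ {b}` are
joined by a path of weight-1 edges (the all-closed-but-forced configuration has positive mass): then a.s.
`N_{A'} = 1, o ↮ b` forces `o` to avoid both, and the claim follows from the claim for `A'` minus those points
(strong induction on `|A'|`), or perturb `w ↦ (1−η)w` and let `η → 0` (probabilities are polynomials in `w`).
RESHAPED by the lead (2026-08-16): the null case is handled by the SECOND hypothesis (weight continuity,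
`stub_weightContinuity`): prove the bound for the perturbed weights `w_k = (1 − 1/(k+2))·w` (all `< 1`, so
`μ_{w_k}(M) ≥ μ_{w_k}{∅} = ∏_e (1 − w_k e) > 0` and the division is legal), with `t` replaced by
`t_k := max(t, max_{a∈A'} μ_{w_k}(a ↮ b))`, then let `k → ∞`: `μ_{w_k}(E) → μ_w(E)` for the three kinds of events
involved (continuity composed with `k ↦ w_k → w` in the product topology), so `t_k → max(t, max_a μ_w(a↮b)) = t`.
Exact-checked, 0 violations (38 690 instances here; 0/146 468 cruxtri r1-3 C1, 0/9 500 cdisprove v5).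
FALSE in the shared-bit model of `BarrierSharedBit.md` (by a factor `n^t/t!`), as every `|A|`-uniform lever
must be — it spends edge-independence through BHK.  Size: M. -/
theorem stub_singleFinger :
    (∀ (n : ℕ) (w : Sym2 (Fin n) → unitInterval) (T : Finset (Fin n)) (o a : Fin n),
      (Literature.Probability.LatticeModels.prodBernoulli w).real
          (Literature.Probability.Percolation.openConn o a ∩
            {ω | ∀ t ∈ T, ω ∉ Literature.Probability.Percolation.openConn a t}) *
        (Literature.Probability.LatticeModels.prodBernoulli w).real
          ({ω | ∀ t ∈ T, ω ∉ Literature.Probability.Percolation.openConn a t} ∩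
            {ω | ∀ t ∈ T, ∀ t' ∈ T, t ≠ t' → ω ∉ Literature.Probability.Percolation.openConn t t'}) ≤
      (Literature.Probability.LatticeModels.prodBernoulli w).real
          {ω | ∀ t ∈ T, ω ∉ Literature.Probability.Percolation.openConn a t} *
        (Literature.Probability.LatticeModels.prodBernoulli w).real
          (Literature.Probability.Percolation.openConn o a ∩
            ({ω | ∀ t ∈ T, ω ∉ Literature.Probability.Percolation.openConn a t} ∩
              {ω | ∀ t ∈ T, ∀ t' ∈ T, t ≠ t' → ω ∉ Literature.Probability.Percolation.openConn t t'}))) →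
    (∀ (n : ℕ) (E : Set (Literature.Probability.Percolation.BondConfig (Fin n))),
      Continuous fun w : Sym2 (Fin n) → unitInterval =>
        (Literature.Probability.LatticeModels.prodBernoulli w).real E) →
    ∀ (n : ℕ) (w : Sym2 (Fin n) → unitInterval) (A' : Finset (Fin n)) (o b : Fin n) (t : ℝ),
      0 ≤ t →
      (∀ a ∈ A', (Literature.Probability.LatticeModels.prodBernoulli w).real
          (Literature.Probability.Percolation.openConn a b)ᶜ ≤ t) →
      (Literature.Probability.LatticeModels.prodBernoulli w).real
          {ω | (A'.filter fun a => ω ∈ Literature.Probability.Percolation.openConn o a).card = 1 ∧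
            ω ∉ Literature.Probability.Percolation.openConn o b} ≤ t :=
  Summit.CriticalPhenomena.PercolationContinuityZ3.Theorems.stub_singleFinger

/-- **stub_dyadicThinning** — DYADIC BERNOULLI THINNING OF THE RELAY SET: the single-finger lemma for every
sub-relay set `A' ⊆ A` implies the WINDOW BOUND
`P(o ↮ b, K ≤ N < K·2^L) ≤ 16 · L · t` for every `K ≥ 1`, `L : ℕ` (`N = |C(o) ∩ A|`,
`t ≥ max_a P(a ↮ b)`): 16·t per dyadic scale of the footprint, nothing else depends on `A`.
Proof: for `j < L` let `ρ = 1/(K 2^j)` and `A'_ρ ⊆ A` keep each point independently with probability `ρ`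
(coins independent of `ω`).  For each realisation the hypothesis gives `μ{|C(o) ∩ A'| = 1, o ↮ b} ≤ t`
(the reliability hypothesis passes to subsets).  Average over the coins and swap the two finite sums
(Fubini on `A.powerset × configurations`): `E_ω[1{o↮b} · Nρ(1−ρ)^{N−1}] ≤ t`, and
`mρ(1−ρ)^{m−1} ≥ (1 − 1/(K2^j))^{2K2^j − 1} ≥ 1/16` for `m ∈ [K2^j, K2^{j+1})` (minimum at `K2^j = 2`;
`= 1` when `K2^j = 1`; cruxtri r1-1 (F): true minimum ≈ 0.27), so `μ{o ↮ b, K2^j ≤ N < K2^{j+1}} ≤ 16 t`;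
sum over `j < L`.  Pure finite sums (`Finset.sum` over `A.powerset` with weights `ρ^{|A'|}(1−ρ)^{|A∖A'|}`), no
measure theory on the coin side.  Exact-checked (K ≤ 3, L ≤ 3; max LHS/RHS = 1/16).  Size: M. -/
theorem stub_dyadicThinning :
    (∀ (n : ℕ) (w : Sym2 (Fin n) → unitInterval) (A' : Finset (Fin n)) (o b : Fin n) (t : ℝ),
      0 ≤ t →
      (∀ a ∈ A', (Literature.Probability.LatticeModels.prodBernoulli w).real
          (Literature.Probability.Percolation.openConn a b)ᶜ ≤ t) →
      (Literature.Probability.LatticeModels.prodBernoulli w).real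
          {ω | (A'.filter fun a => ω ∈ Literature.Probability.Percolation.openConn o a).card = 1 ∧
            ω ∉ Literature.Probability.Percolation.openConn o b} ≤ t) →
    ∀ (n : ℕ) (w : Sym2 (Fin n) → unitInterval) (A : Finset (Fin n)) (o b : Fin n) (t : ℝ) (K L : ℕ),
      0 ≤ t → 1 ≤ K →
      (∀ a ∈ A, (Literature.Probability.LatticeModels.prodBernoulli w).real
          (Literature.Probability.Percolation.openConn a b)ᶜ ≤ t) →
      (Literature.Probability.LatticeModels.prodBernoulli w).real
          {ω | ω ∉ Literature.Probability.Percolation.openConn o b ∧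
            K ≤ (A.filter fun a => ω ∈ Literature.Probability.Percolation.openConn o a).card ∧
            (A.filter fun a => ω ∈ Literature.Probability.Percolation.openConn o a).card < K * 2 ^ L} ≤
        16 * (L : ℝ) * t :=
  Summit.CriticalPhenomena.PercolationContinuityZ3.Theorems.stub_dyadicThinning

/-- **stub_doomWindow** — THE RESIDUAL (open-problem grade; the line's crux).  For every `ε > 0` there is
`δ > 0` such that, with `L = ⌈1/δ⌉`, on every finite weighted graph with `P(o ↮ A) ≤ δ` and
`P(a ↮ b) ≤ δ ∀ a ∈ A`:  `P(o ↮ b, 2^L ≤ N, N·2^L ≤ |A|) ≤ ε`  (`N = |C(o) ∩ A|`).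
In words: bad configurations in which `o`'s pocket swallows at least `2^{1/δ}` relay points — each of them
`(1−δ)`-reliably glued to `b` — while still capturing at most a `2^{-1/δ}` fraction of `A`, are rare,
UNIFORMLY in `|A|`.  Status, stated plainly: given stubs 1–4 this is EQUIVALENT to the crux
(`nearOneGluing_iff_doomWindow` below) — it is Kozma–Nitzan's Conjecture 3 restricted to the one regime the
single-finger budget provably cannot reach (the LP over exchangeable footprint laws subject to every
single-finger constraint is maximised by the harmonic law `P(|R| = m) = δ/m`, value `δ·H_{|A|}`, card §(5));
it is vacuous unless `|A| ≥ 4^{1/δ}`, and automatically true (Harris–Markov, `E[N; o↮b] ≤ δ·E N`) unless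
`E N ≥ ε·2^{1/δ}/δ`.  Why it might be TRUE beyond "Conj 3 is believed": a counterexample law must (a) put
`δ`-mass on each of `≳ ε/δ` dyadic footprint scales inside the window, (b) keep footprints pointwise
`(δ/u)`-sparse yet pairwise intersecting with independent copies of the leftover set `A ∖ C(b)`
(card independent-bad-world, LargeFootprint), (c) simulate "shared bits" without sharing connectivity
(BarrierSharedBit.md; Gladkov–Zimin arXiv:2404.08873 Thms 1.5–1.6 forbid the exact version).  K2 menu for
the lead (each would be filed as `C⁺ → stub_doomWindow`): laminar/multi-scale BHK ("KN Lemma 2 is depth 1";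
card sparse-relay-bhk-log-uniform §4(ii)), scale decay above `u/δ` via freshness (independent-bad-world K2),
two-copy splicing of the BFS entrance (sentinel-duality K2).  Cheapest falsifier: a hierarchical-gadget
partition-DP (≤ 6 terminals, depth ≤ 30) realising `δ`-mass per scale across ≫ 1/δ scales. -/
theorem stub_doomWindow :
    ∀ ε : ℝ, 0 < ε → ∃ δ : ℝ, 0 < δ ∧
      ∀ (n : ℕ) (w : Sym2 (Fin n) → unitInterval) (A : Finset (Fin n)) (o b : Fin n),
        (Literature.Probability.LatticeModels.prodBernoulli w).real
            (⋃ a ∈ A, Literature.Probability.Percolation.openConn o a)ᶜ ≤ δ →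
        (∀ a ∈ A, (Literature.Probability.LatticeModels.prodBernoulli w).real
            (Literature.Probability.Percolation.openConn a b)ᶜ ≤ δ) →
        (Literature.Probability.LatticeModels.prodBernoulli w).real
            {ω | ω ∉ Literature.Probability.Percolation.openConn o b ∧
              2 ^ ⌈1 / δ⌉₊ ≤ (A.filter fun a => ω ∈ Literature.Probability.Percolation.openConn o a).card ∧
              (A.filter fun a => ω ∈ Literature.Probability.Percolation.openConn o a).card * 2 ^ ⌈1 / δ⌉₊
                ≤ A.card} ≤ ε := by
  sorry

/-! ## The statements as named Props (for the sorry-free glue below; definitionally the stub types) -/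

/-- Window bound (conclusion of `stub_dyadicThinning`). -/
def WindowBound : Prop :=
  ∀ (n : ℕ) (w : Sym2 (Fin n) → unitInterval) (A : Finset (Fin n)) (o b : Fin n) (t : ℝ) (K L : ℕ),
    0 ≤ t → 1 ≤ K →
    (∀ a ∈ A, (prodBernoulli w).real (openConn a b)ᶜ ≤ t) →
    (prodBernoulli w).real
        {ω | ω ∉ openConn o b ∧ K ≤ (A.filter fun a => ω ∈ openConn o a).card ∧
          (A.filter fun a => ω ∈ openConn o a).card < K * 2 ^ L} ≤ 16 * (L : ℝ) * t

/-- Doom-window residual (type of `stub_doomWindow`). -/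
def DoomWindow : Prop :=
  ∀ ε : ℝ, 0 < ε → ∃ δ : ℝ, 0 < δ ∧
    ∀ (n : ℕ) (w : Sym2 (Fin n) → unitInterval) (A : Finset (Fin n)) (o b : Fin n),
      (prodBernoulli w).real (⋃ a ∈ A, openConn o a)ᶜ ≤ δ →
      (∀ a ∈ A, (prodBernoulli w).real (openConn a b)ᶜ ≤ δ) →
      (prodBernoulli w).real
          {ω | ω ∉ openConn o b ∧ 2 ^ ⌈1 / δ⌉₊ ≤ (A.filter fun a => ω ∈ openConn o a).card ∧
            (A.filter fun a => ω ∈ openConn o a).card * 2 ^ ⌈1 / δ⌉₊ ≤ A.card} ≤ ε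

/-- `LogGluing` — the card's headline consequence (KN Conjecture 3 with a `log|A|` loss). -/
def LogGluing : Prop :=
  ∀ (n : ℕ) (w : Sym2 (Fin n) → unitInterval) (A : Finset (Fin n)) (o b : Fin n) (t : ℝ), 0 ≤ t →
    (∀ a ∈ A, (prodBernoulli w).real (openConn a b)ᶜ ≤ t) →
    (prodBernoulli w).real (openConn o b)ᶜ ≤
      (prodBernoulli w).real (⋃ a ∈ A, openConn o a)ᶜ + 16 * ((Nat.log 2 A.card + 1 : ℕ) : ℝ) * t

/-- BHK Thm 1.1 at `V = Fin n`, events form (type of `stub_bhkLogSupermodular`). -/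
def BHKLogSupermodularFin : Prop :=
  ∀ (n : ℕ) (w : Sym2 (Fin n) → unitInterval) (s : Fin n) (X Y : Set (Fin n))
    (A B : Set (Literature.Probability.Percolation.BondConfig (Fin n))),
    (∀ ω ω', ω ∈ A → Literature.Probability.Percolation.openEdgeCluster ω s ⊆
        Literature.Probability.Percolation.openEdgeCluster ω' s → ω' ∈ A) →
    (∀ ω ω', ω ∈ B → Literature.Probability.Percolation.openEdgeCluster ω s ⊆
        Literature.Probability.Percolation.openEdgeCluster ω' s → ω' ∈ B) →
    s ∉ X → s ∉ Y →
    (prodBernoulli w).real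
        (A ∩ {ω | ∀ x ∈ X, ¬ (Literature.Probability.Percolation.openGraph ω).Reachable s x}) *
      (prodBernoulli w).real
        (B ∩ {ω | ∀ y ∈ Y, ¬ (Literature.Probability.Percolation.openGraph ω).Reachable s y}) ≤
    (prodBernoulli w).real
        (A ∩ B ∩ {ω | ∀ z ∈ X ∩ Y, ¬ (Literature.Probability.Percolation.openGraph ω).Reachable s z}) *
      (prodBernoulli w).real
        {ω | ∀ z ∈ X ∪ Y, ¬ (Literature.Probability.Percolation.openGraph ω).Reachable s z}

/-- Continuity of event probabilities in the weights (type of `stub_weightContinuity`). -/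
def WeightContinuity : Prop :=
  ∀ (n : ℕ) (E : Set (Literature.Probability.Percolation.BondConfig (Fin n))),
    Continuous fun w : Sym2 (Fin n) → unitInterval => (prodBernoulli w).real E

/-- BHK Thm 1.3 at `V = Fin n` (conclusion of `stub_bhkClusterAssociation`, hypothesis of `stub_terminalSeparation`). -/
def BHKClusterAssociationFin : Prop :=
  ∀ (n : ℕ) (w : Sym2 (Fin n) → unitInterval) (s : Fin n) (X : Set (Fin n))
    (F G : Set (Sym2 (Fin n)) → ℝ), Monotone F → Monotone G → s ∉ X →
    (∫ ω in {ω : Literature.Probability.Percolation.BondConfig (Fin n) |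
          ∀ x ∈ X, ¬ (Literature.Probability.Percolation.openGraph ω).Reachable s x},
        F (Literature.Probability.Percolation.openEdgeCluster ω s)
          ∂(Literature.Probability.LatticeModels.prodBernoulli w)) *
      (∫ ω in {ω : Literature.Probability.Percolation.BondConfig (Fin n) |
          ∀ x ∈ X, ¬ (Literature.Probability.Percolation.openGraph ω).Reachable s x},
        G (Literature.Probability.Percolation.openEdgeCluster ω s)
          ∂(Literature.Probability.LatticeModels.prodBernoulli w)) ≤
    (Literature.Probability.LatticeModels.prodBernoulli w).real
        {ω : Literature.Probability.Percolation.BondConfig (Fin n) |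
          ∀ x ∈ X, ¬ (Literature.Probability.Percolation.openGraph ω).Reachable s x} *
      ∫ ω in {ω : Literature.Probability.Percolation.BondConfig (Fin n) |
          ∀ x ∈ X, ¬ (Literature.Probability.Percolation.openGraph ω).Reachable s x},
        F (Literature.Probability.Percolation.openEdgeCluster ω s) *
          G (Literature.Probability.Percolation.openEdgeCluster ω s)
          ∂(Literature.Probability.LatticeModels.prodBernoulli w)

/-! ## Sorry-free glue and certificates -/

/-- The tree's named fact (all finite `V`, any universe) specialises to the registered stub 1: when a
`…_holds` proof of `BHK2006_clusterConditionalPositiveAssociation` lands in Literature, `stub_bhkClusterAssociation`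
closes by this one line. -/
theorem bhkClusterAssociationFin_of_fact
    (h : Literature.Probability.Percolation.BHK2006_clusterConditionalPositiveAssociation.{0}) :
    BHKClusterAssociationFin :=
  fun n w s X F G hF hG hs => h (Fin n) w s X F G hF hG hs

/-- Definitional bookkeeping: the reshaped stubs compose (stub 1a feeds stub 1b, which is what stub 2 consumes). -/
example : BHKLogSupermodularFin := stub_bhkLogSupermodular

example : BHKClusterAssociationFin := stub_bhkClusterAssociation stub_bhkLogSupermodular

example : WeightContinuity := stub_weightContinuity

/-- **LogGluing from the window bound** (sorry-free): `P(o ↮ b) ≤ P(o ↮ A) + 16(⌊log₂|A|⌋ + 1)·t` —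
take `K = 1` and `L = ⌊log₂|A|⌋ + 1` scales, which exhaust `N ≤ |A| < 2^L`.  Corollary for disprovers:
a counterexample to the crux at `(ε, δ)` needs `⌊log₂|A|⌋ + 1 ≥ (ε − δ)/(16δ)`; exhaustive sweeps on ≤ 9
vertices can refute the CONSTANT of AdditiveGluing (stmt-4576) but never the crux. -/
theorem logGluing_of_windowBound (hWB : WindowBound) : LogGluing := by
  intro n w A o b t ht hB
  set μ := prodBernoulli w with hμ
  set L : ℕ := Nat.log 2 A.card + 1 with hL
  have hAL : A.card < 2 ^ L := Nat.lt_pow_succ_log_self (by norm_num) _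
  set P0 : Set (Set (Sym2 (Fin n))) := (⋃ a ∈ A, openConn o a)ᶜ with hP0
  set P1 : Set (Set (Sym2 (Fin n))) :=
    {ω | ω ∉ openConn o b ∧ 1 ≤ (A.filter fun a => ω ∈ openConn o a).card ∧
      (A.filter fun a => ω ∈ openConn o a).card < 1 * 2 ^ L} with hP1
  have h1 : μ.real P1 ≤ 16 * (L : ℝ) * t := hWB n w A o b t 1 L ht le_rfl hB
  have hcover : (openConn o b)ᶜ ⊆ P0 ∪ P1 := by
    intro ω hω
    have hωb : ω ∉ openConn o b := hω
    by_cases hz : (A.filter fun a => ω ∈ openConn o a).card = 0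
    · refine Or.inl ?_
      rw [hP0, Set.mem_compl_iff, Set.mem_iUnion₂]
      rintro ⟨a, ha, hoa⟩
      have : a ∈ A.filter fun a => ω ∈ openConn o a := Finset.mem_filter.2 ⟨ha, hoa⟩
      rw [Finset.card_eq_zero] at hz
      simp [hz] at this
    · refine Or.inr ⟨hωb, Nat.one_le_iff_ne_zero.2 hz, ?_⟩
      have hNle : (A.filter fun a => ω ∈ openConn o a).card ≤ A.card := Finset.card_filter_le _ _
      simpa using lt_of_le_of_lt hNle hAL
  calc μ.real (openConn o b)ᶜ ≤ μ.real (P0 ∪ P1) := measureReal_mono hcover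
    _ ≤ μ.real P0 + μ.real P1 := measureReal_union_le _ _
    _ ≤ μ.real P0 + 16 * ((Nat.log 2 A.card + 1 : ℕ) : ℝ) * t := by rw [← hL]; linarith

/-- **The reduction** (sorry-free, hypotheses explicit): window bound + doom window ⇒ Kozma–Nitzan
Conjecture 3.  Given `ε`, the residual at `ε/4` freezes `δ₅` and `L = ⌈1/δ₅⌉`; then
`δ := min(δ₅, ε/(64(L+1)))`; the bad event splits by the footprint `N` into `N = 0` (costs `P(o ↮ A) < δ`),
`1 ≤ N < 2^L` (`16Lδ`), the doom window (`ε/4`), and `N > |A|/2^L` (`L+1` dyadic scales from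
`K₃ = |A|/2^L + 1`, `16(L+1)δ`); total `< ε`.  The conclusion is the crux statement unfolded (kept off the
by-name audit on purpose; `NearOneGluing_of` is the by-name theorem). -/
theorem nearOneGluing_of_parts (hWB : WindowBound) (hDW : DoomWindow) :
    ∀ ε : ℝ, 0 < ε → ∃ δ : ℝ, 0 < δ ∧ ∀ (n : ℕ) (w : Sym2 (Fin n) → unitInterval) (A : Finset (Fin n))
      (o b : Fin n), 1 - δ < (prodBernoulli w).real (⋃ a ∈ A, openConn o a) →
      (∀ a ∈ A, 1 - δ < (prodBernoulli w).real (openConn a b)) →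
      1 - ε < (prodBernoulli w).real (openConn o b) := by
  intro ε hε
  -- the residual fixes the number of dyadic scales `L` that the window bound has to pay for
  obtain ⟨δ₅, hδ₅, hDW⟩ := hDW (ε / 4) (by positivity)
  set L : ℕ := ⌈1 / δ₅⌉₊ with hL
  have hL0 : (0 : ℝ) ≤ L := Nat.cast_nonneg L
  refine ⟨min δ₅ (ε / (64 * ((L : ℝ) + 1))), lt_min hδ₅ (by positivity), ?_⟩
  intro n w A o b hA hB
  set δ : ℝ := min δ₅ (ε / (64 * ((L : ℝ) + 1))) with hδdef
  have hδ₅' : δ ≤ δ₅ := min_le_left _ _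
  have hδε : δ ≤ ε / (64 * ((L : ℝ) + 1)) := min_le_right _ _
  have hδpos : 0 < δ := lt_min hδ₅ (by positivity)
  set μ := prodBernoulli w with hμ
  -- hypotheses in complement form
  have hmeas : ∀ x y : Fin n, MeasurableSet (openConn x y : Set (Set (Sym2 (Fin n)))) :=
    fun x y => measurableSet_openConn_holds x y
  have hAc : μ.real (⋃ a ∈ A, openConn o a)ᶜ < δ := by
    rw [measureReal_compl (Finset.measurableSet_biUnion A fun a _ => hmeas o a), probReal_univ]
    linarith
  have hBc : ∀ a ∈ A, μ.real (openConn a b)ᶜ ≤ δ := by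
    intro a ha
    rw [measureReal_compl (hmeas a b), probReal_univ]
    linarith [hB a ha]
  -- the four pieces of the bad event
  set P0 : Set (Set (Sym2 (Fin n))) := (⋃ a ∈ A, openConn o a)ᶜ with hP0
  set P1 : Set (Set (Sym2 (Fin n))) :=
    {ω | ω ∉ openConn o b ∧ 1 ≤ (A.filter fun a => ω ∈ openConn o a).card ∧
      (A.filter fun a => ω ∈ openConn o a).card < 1 * 2 ^ L} with hP1
  set P2 : Set (Set (Sym2 (Fin n))) :=
    {ω | ω ∉ openConn o b ∧ 2 ^ ⌈1 / δ₅⌉₊ ≤ (A.filter fun a => ω ∈ openConn o a).card ∧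
      (A.filter fun a => ω ∈ openConn o a).card * 2 ^ ⌈1 / δ₅⌉₊ ≤ A.card} with hP2
  set K₃ : ℕ := A.card / 2 ^ L + 1 with hK₃
  set P3 : Set (Set (Sym2 (Fin n))) :=
    {ω | ω ∉ openConn o b ∧ K₃ ≤ (A.filter fun a => ω ∈ openConn o a).card ∧
      (A.filter fun a => ω ∈ openConn o a).card < K₃ * 2 ^ (L + 1)} with hP3
  have h0 : μ.real P0 < δ := hAc
  have h1 : μ.real P1 ≤ 16 * (L : ℝ) * δ := hWB n w A o b δ 1 L hδpos.le le_rfl hBc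
  have h2 : μ.real P2 ≤ ε / 4 :=
    hDW n w A o b (hAc.le.trans hδ₅') (fun a ha => (hBc a ha).trans hδ₅')
  have h3 : μ.real P3 ≤ 16 * ((L + 1 : ℕ) : ℝ) * δ :=
    hWB n w A o b δ K₃ (L + 1) hδpos.le (Nat.le_add_left 1 _) hBc
  -- they cover the bad event
  have hcover : (openConn o b)ᶜ ⊆ ((P0 ∪ P1) ∪ P2) ∪ P3 := by
    intro ω hω
    have hωb : ω ∉ openConn o b := hω
    have hpow : 0 < 2 ^ L := pow_pos (by norm_num : (0 : ℕ) < 2) L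
    by_cases hz : (A.filter fun a => ω ∈ openConn o a).card = 0
    · -- N = 0 : o is joined to no relay point
      refine Or.inl (Or.inl (Or.inl ?_))
      rw [hP0, Set.mem_compl_iff, Set.mem_iUnion₂]
      rintro ⟨a, ha, hoa⟩
      have : a ∈ A.filter fun a => ω ∈ openConn o a := Finset.mem_filter.2 ⟨ha, hoa⟩
      rw [Finset.card_eq_zero] at hz
      simp [hz] at this
    · have h1N : 1 ≤ (A.filter fun a => ω ∈ openConn o a).card := Nat.one_le_iff_ne_zero.2 hz
      by_cases hsmall : (A.filter fun a => ω ∈ openConn o a).card < 2 ^ L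
      · refine Or.inl (Or.inl (Or.inr ?_))
        exact ⟨hωb, h1N, by simpa using hsmall⟩
      · have hsmall : 2 ^ L ≤ (A.filter fun a => ω ∈ openConn o a).card := not_lt.1 hsmall
        by_cases hmid : (A.filter fun a => ω ∈ openConn o a).card * 2 ^ L ≤ A.card
        · refine Or.inl (Or.inr ?_)
          exact ⟨hωb, hsmall, hmid⟩
        · have hmid : A.card < (A.filter fun a => ω ∈ openConn o a).card * 2 ^ L := not_le.1 hmid
          refine Or.inr ⟨hωb, ?_, ?_⟩
          · -- |A| < N·2^L  ⇒  |A| / 2^L + 1 ≤ N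
            have : A.card / 2 ^ L < (A.filter fun a => ω ∈ openConn o a).card :=
              (Nat.div_lt_iff_lt_mul hpow).2 hmid
            exact this
          · -- N ≤ |A| < (|A| / 2^L + 1)·2^L ≤ K₃·2^(L+1)
            have hNle : (A.filter fun a => ω ∈ openConn o a).card ≤ A.card := Finset.card_filter_le _ _
            have hlt : A.card < (A.card / 2 ^ L + 1) * 2 ^ L := by
              have := Nat.lt_div_mul_add (a := A.card) hpow
              simpa [Nat.add_mul, Nat.div_mul_cancel] using this
            calc (A.filter fun a => ω ∈ openConn o a).card ≤ A.card := hNle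
              _ < (A.card / 2 ^ L + 1) * 2 ^ L := hlt
              _ ≤ K₃ * 2 ^ (L + 1) := by
                rw [hK₃]
                exact Nat.mul_le_mul_left _ (Nat.pow_le_pow_right (by norm_num) (Nat.le_succ L))
  have hbad : μ.real (openConn o b)ᶜ ≤ μ.real P0 + μ.real P1 + μ.real P2 + μ.real P3 :=
    calc μ.real (openConn o b)ᶜ ≤ μ.real (((P0 ∪ P1) ∪ P2) ∪ P3) := measureReal_mono hcover
      _ ≤ μ.real ((P0 ∪ P1) ∪ P2) + μ.real P3 := measureReal_union_le _ _
      _ ≤ μ.real (P0 ∪ P1) + μ.real P2 + μ.real P3 := by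
          gcongr; exact measureReal_union_le _ _
      _ ≤ μ.real P0 + μ.real P1 + μ.real P2 + μ.real P3 := by
          gcongr; exact measureReal_union_le _ _
  -- arithmetic: δ + 16Lδ + ε/4 + 16(L+1)δ < ε because δ ≤ ε / (64 (L+1))
  have hkey : δ * (64 * ((L : ℝ) + 1)) ≤ ε := by
    have hpos : (0 : ℝ) < 64 * ((L : ℝ) + 1) := by positivity
    exact (le_div_iff₀ hpos).1 hδε
  have hcast : ((L + 1 : ℕ) : ℝ) = (L : ℝ) + 1 := by push_cast; ring
  have hfin : μ.real (openConn o b)ᶜ < ε := by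
    rw [hcast] at h3
    nlinarith [hbad, h0, h1, h2, h3, hL0, hδpos, hkey]
  rw [measureReal_compl (hmeas o b), probReal_univ] at hfin
  linarith

/-- Honesty certificate (sorry-free): the crux implies the residual (drop the window condition). -/
theorem doomWindow_of_nearOneGluing (hX : NearOneGluing) : DoomWindow := by
  intro ε hε
  obtain ⟨δ₀, hδ₀, hX⟩ := hX ε hε
  refine ⟨δ₀ / 2, by positivity, ?_⟩
  intro n w A o b hA hB
  set μ := prodBernoulli w with hμ
  have hmeas : ∀ x y : Fin n, MeasurableSet (openConn x y : Set (Set (Sym2 (Fin n)))) :=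
    fun x y => measurableSet_openConn_holds x y
  have hA' : 1 - δ₀ < μ.real (⋃ a ∈ A, openConn o a) := by
    rw [measureReal_compl (Finset.measurableSet_biUnion A fun a _ => hmeas o a), probReal_univ] at hA
    linarith
  have hB' : ∀ a ∈ A, 1 - δ₀ < μ.real (openConn a b) := by
    intro a ha
    have := hB a ha
    rw [measureReal_compl (hmeas a b), probReal_univ] at this
    linarith
  have hgoal := hX n w A o b hA' hB'
  have hc : μ.real (openConn o b)ᶜ < ε := by
    rw [measureReal_compl (hmeas o b), probReal_univ]; linarith
  refine le_of_lt (lt_of_le_of_lt (measureReal_mono ?_) hc)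
  intro ω hω
  exact hω.1

/-- Hence, modulo the PROVABLE stubs 1–4 (which give `WindowBound`), the registered residual is exactly as
strong as the crux — recorded so that nobody mistakes `stub_doomWindow` for a weaker target. -/
theorem nearOneGluing_iff_doomWindow (hWB : WindowBound) : NearOneGluing ↔ DoomWindow :=
  ⟨doomWindow_of_nearOneGluing, fun hDW => nearOneGluing_of_parts hWB hDW⟩

/-! ## Composition (kernel-checked; concludes the crux BY NAME; no sorry of its own) -/

/-- **The line concludes the crux by name.**  `stub_bhkLogSupermodular → stub_bhkClusterAssociation →
stub_terminalSeparation → stub_singleFinger (+ stub_weightContinuity) → stub_dyadicThinning` give `WindowBound`;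
with `stub_doomWindow`, `nearOneGluing_of_parts` is Kozma–Nitzan's Conjecture 3 = `PercNearOneGluing.NearOneGluing`. -/
theorem NearOneGluing_of : NearOneGluing :=
  nearOneGluing_of_parts
    (stub_dyadicThinning
      (stub_singleFinger (stub_terminalSeparation (stub_bhkClusterAssociation stub_bhkLogSupermodular))
        stub_weightContinuity))
    stub_doomWindow

end Summit.CriticalPhenomena.PercolationContinuityZ3.Cruxes.NearOneGluing.BhkDyadicThinning
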